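/-
Copyright (c) 2026 the pub-hodgecm-mathlib formalisation cell (harness21).  Prover seat hodgecm-mathlib-F0P3a-p04 (g31): E1 row 47d, FILE 5b «THE ISOTYPIC EULER IDENTITY OF THE
JACQUET MODULE OF THE SCHNEIDER–STUHLER RESOLUTION ON THE TREE» (instantiation of ★ 47c-4χ(b) `sum_finrank_block_eigen_eq_of_shortExact` (LH5-p02) at FILE 5a's global complex,
with the analytic input `hsurj` discharged by ★ 41e; dealt by the E1 keeper F0P3a-p03 (g30) 02:58:32Z), 2026-09-03.
-/
import Literature.NumberTheory.Automorphic.JacquetEulerBlockPermutationIsotypic   -- ★ 47c-4χ(b) (LH5-p02): `sum_finrank_block_eigen_eq_of_shortExact`; brings ★ FILE 4, FILE 3, `JacquetModule`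
import Literature.NumberTheory.Automorphic.SchneiderStuhlerTreeComplexGlobal       -- FILE 5a (this seat): the global complex as a short exact sequence of smooth `Γ`-representations by blocks
import Literature.NumberTheory.Automorphic.CompactOpenAveragingExact               -- ★ 41e R-e: `restrict_fixedPoints_surjective`
import Literature.NumberTheory.Automorphic.IntertwiningMapCharacterCoinvariants    -- ★ 47d G3: `exists_twistInv`, `mem_fixedPoints_twistInv_iff`
import HarnessLib

/-!
# The isotypic Euler identity of the Jacquet module of the Schneider–Stuhler resolution on the tree

Topic `NumberTheory/Automorphic`; namespace `Representation`; THEOREMS ONLY (no definition, instance, notation or named fact); imports ★ 47c-4χ(b), FILE 5a, ★ 41e, ★ 47d-G3,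
HarnessLib.  Cell `pub/hodgecm-mathlib` (D-0151), crux H413 = `stmt-HodgeConjecture-24833`, lane `--supports`; E1 row 47d (β) «FILE 5» = the `hEuler` discharger of ★ 47d HEAD
`smoothTrace_epFunction_eq_zero_of_blockSums` in the (E)-currency.  Count-neutral generic base layer; HC_CM is proved only modulo the 7 printed citations (2 remaining named inputs:
hLiu418 = `stmt-HodgeConjecture-24832`, h413 = `stmt-HodgeConjecture-24833`) until rung 0 closes.

* §1 `exists_mem_eigen_jacquetMap_eq` — THE ONE ANALYTIC INPUT `hsurj` of ★ 4χ(b): for a COMPACT `C ≤ M` and a character `χ : C →* kˣ` with open kernel, a surjective intertwining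
  map `g : M₀ ↠ V` of `G`-representations with `M₀` SMOOTH maps the `χ`-eigenspace of `C` in `(M₀)_N` ONTO the `χ`-eigenspace in `V_N` (★ 41e `restrict_fixedPoints_surjective` for the
  `χ⁻¹`-twist, ★ G3 `exists_twistInv` ∕ `mem_fixedPoints_twistInv_iff`; smoothness of the twist on `↥C`: `isSmooth_twist_jacquetModule`).
* §2 **`sum_finrank_block_eigen_eq_of_tree`** — ★ 4χ(b) §4 at the global Schneider–Stuhler complex of FILE 5a: for `G` a tree with a `Γ`-action, compact open vertex groups with
  (U6)–(U7) transported by `Γ` and an invariant orientation, `ρ` smooth with finite-dimensional `V^{U_x}`, `Γ`-representations `ρ₁ ρ₀ ρV` on `C₁(X)`, `C₀(X)`, `V|_X` agreeing with the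
  chain actions (FILE 5a `exists_reps_univ`), a parabolic triple `t = (P, M, N)` of `Γ` with `N` a union of compact opens, and — HYPOTHESIS-STYLE, the Bruhat–Tits datum of row 47e —
  orbit representatives `R_q` with `rep_q`, `tr_q`, heights `ht_q` shifted by a torus element `τ ∈ M`, a compact `C ≤ M` commuting with `τ` and fixing the representatives,
  `χ : C →* kˣ` with open kernel, the `χ`-eigenspaces `E₁ E₀ E_V` and `V_N` finite-dimensional:
  `Σ_{r ∈ S₁} dim ([W¹_r] ⊓ E₁) = Σ_{r ∈ S₀} dim ([W⁰_r] ⊓ E₀)` over the height-`0` representatives.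
* The (E)-BRIDGE to ★ 47d-(α)'s currency (`finrank ↥Eig` on the local Jacquet module `(V^{U_r})_{N ∩ P_r}` = `finrank ↥([W_r] ⊓ E)`) is the sibling generic file
  `Literature/RepresentationTheory/CoinvariantsBlockLocalModel.lean` (G4).

## References
* [SchneiderStuhler1997] P. Schneider, U. Stuhler, *Representation theory and sheaves on the Bruhat–Tits building*, Publ. Math. IHÉS 85 (1997), Ch. II §3, Ch. III §4 (Lemma III.4.13).
* [BernsteinZelevinsky1976] I. N. Bernstein, A. V. Zelevinsky, *Representations of the group `GL(n,F)`*, Russian Math. Surveys 31 (1976), §2.3 (Prop. 2.35; isotypic components).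
* [Casselman1995] W. Casselman, *Introduction to the theory of admissible representations of `p`-adic reductive groups* (1995 notes), §2.1, §3.2, §6.3.
* [MeyerSolleveld2010] R. Meyer, M. Solleveld, *Resolutions for representations of reductive p-adic groups via their buildings*, J. reine angew. Math. 647 (2010), Thm. 2.4.
-/

set_option autoImplicit false

open scoped BigOperators Pointwise
open SimpleGraph Finset
open Literature.NumberTheory.Automorphic Literature.Combinatorics.SimpleGraph Literature.Combinatorics.SimpleGraph.OrientedIncidence

namespace Representation

/-! ## §1 The `χ`-eigenspaces of a compact torus are exact under a surjection of smooth representations -/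

section Isotypic

variable {k G M₀ V : Type*} [Field k] [CharZero k] [Group G] [TopologicalSpace G] [IsTopologicalGroup G]
  [AddCommGroup M₀] [Module k M₀] [AddCommGroup V] [Module k V] (t : ParabolicTriple G) {ρ₀ : Representation k G M₀} {ρV : Representation k G V}

omit [CharZero k] in
/-- **THE `χ⁻¹`-TWIST OF THE JACQUET MODULE IS A SMOOTH `C`-REPRESENTATION** (`C` with the subspace topology): its stabilisers contain `Stab_{ρ₀}(v) ∩ ker χ`, open for `ρ₀` smooth
and `ker χ` open. [cite: Casselman1995, §2.1, §3.2] -/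
theorem isSmooth_twist_jacquetModule (h₀ : ρ₀.IsSmooth) (C : Subgroup G) (hCM : C ≤ t.M) (χ : C →* kˣ) (hχo : IsOpen (χ.ker : Set C))
    {σ' : Representation k C (t.restrict ρ₀).Coinvariants}
    (hσ' : ∀ (c : C) (x : (t.restrict ρ₀).Coinvariants), σ' c x = ((χ c : kˣ) : k)⁻¹ • (ρ₀.jacquetModule t ⟨c, hCM c.2⟩ : _ →ₗ[k] _) x) : σ'.IsSmooth := by
  intro x
  obtain ⟨v, rfl⟩ := Coinvariants.mk_surjective _ x
  refine isSmoothVector_of_le σ' (K := (ρ₀.stabilizerSubgroup v).comap C.subtype ⊓ χ.ker) ?_ fun c hc => ?_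
  · rw [Subgroup.coe_inf, Subgroup.coe_comap]
    exact ((h₀ v).preimage continuous_subtype_val).inter hχo
  · obtain ⟨h1, h2⟩ := Subgroup.mem_inf.1 hc
    rw [Subgroup.mem_comap, mem_stabilizerSubgroup, Subgroup.coe_subtype] at h1
    rw [MonoidHom.mem_ker] at h2
    rw [mem_stabilizerSubgroup, hσ', h2, Units.val_one, inv_one, one_smul, jacquetModule_mk]
    exact congrArg _ h1

/-- **`hsurj` OF ★ 4χ(b): THE `χ`-EIGENSPACE OF `(M₀)_N` MAPS ONTO THE `χ`-EIGENSPACE OF `V_N`** along `r(g)` for a surjective intertwining map `g : M₀ ↠ V`, `M₀` smooth, `C ≤ M`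
COMPACT, `χ : C →* kˣ` with open kernel (`char k = 0`): the eigenspaces are the invariants of the `χ⁻¹`-twists (★ G3), `r(g)` is onto (★ Jacquet right-exactness), and invariants of
a compact group acting smoothly are exact (★ 41e). [cite: BernsteinZelevinsky1976, §2.3, Prop. 2.35] [cite: Casselman1995, §3.2] -/
theorem exists_mem_eigen_jacquetMap_eq (h₀ : ρ₀.IsSmooth) (g : ρ₀.IntertwiningMap ρV) (hg : Function.Surjective g)
    (C : Subgroup G) (hCM : C ≤ t.M) (hC : IsCompact (C : Set G)) (χ : C →* kˣ) (hχo : IsOpen (χ.ker : Set C))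
    {E₀ : Submodule k (t.restrict ρ₀).Coinvariants} (hE₀ : ∀ x, x ∈ E₀ ↔ ∀ c : C, (ρ₀.jacquetModule t ⟨c, hCM c.2⟩ : _ →ₗ[k] _) x = ((χ c : kˣ) : k) • x)
    {EV : Submodule k (t.restrict ρV).Coinvariants} (hEV : ∀ x, x ∈ EV ↔ ∀ c : C, (ρV.jacquetModule t ⟨c, hCM c.2⟩ : _ →ₗ[k] _) x = ((χ c : kˣ) : k) • x) :
    ∀ z ∈ EV, ∃ y ∈ E₀, jacquetMap t g y = z := by
  -- the `C`-representations on the two Jacquet modules and their `χ⁻¹`-twists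
  obtain ⟨σ₀', hσ₀'⟩ := exists_twistInv ((ρ₀.jacquetModule t).comp (Subgroup.inclusion hCM)) χ
  obtain ⟨σV', hσV'⟩ := exists_twistInv ((ρV.jacquetModule t).comp (Subgroup.inclusion hCM)) χ
  have hK : IsCompact ((⊤ : Subgroup C) : Set C) := by
    rw [Subgroup.coe_top]
    exact (isCompact_iff_compactSpace.1 hC).isCompact_univ
  have hsm : σ₀'.IsSmooth := isSmooth_twist_jacquetModule t h₀ C hCM χ hχo (fun c x => hσ₀' c x)
  have hq : ∀ (c : C) (x : (t.restrict ρ₀).Coinvariants), (jacquetMap t g).toLinearMap (σ₀' c x) = σV' c ((jacquetMap t g).toLinearMap x) := fun c x => by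
    rw [hσ₀', hσV', map_smul, IntertwiningMap.toLinearMap_apply]
    exact congrArg _ (IntertwiningMap.isIntertwining _ _ (jacquetMap t g) ⟨c, hCM c.2⟩ x)
  have hsurj := restrict_fixedPoints_surjective (K := ⊤) hK hsm (jacquetMap t g).toLinearMap hq (jacquetMap_surjective t g hg)
  intro z hz
  have hz' : z ∈ σV'.fixedPoints ⊤ := (mem_fixedPoints_twistInv_iff hσV' ⊤ z).2 fun c _ => (hEV z).1 hz c
  obtain ⟨⟨y, hy⟩, hyz⟩ := hsurj ⟨z, hz'⟩
  refine ⟨y, (hE₀ y).2 fun c => (mem_fixedPoints_twistInv_iff hσ₀' ⊤ y).1 hy c (Subgroup.mem_top c), ?_⟩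
  exact congrArg Subtype.val hyz

end Isotypic

/-! ## §2 The isotypic Euler identity at the global Schneider–Stuhler complex -/

section Tree

variable {k Γ V : Type*} [Field k] [CharZero k] [Group Γ] [TopologicalSpace Γ] [IsTopologicalGroup Γ]
  [AddCommGroup V] [Module k V] {ρ : Representation k Γ V}
variable {ι : Type*} [DecidableEq ι] {G : SimpleGraph ι} {a : Γ →* (G ≃g G)}
variable {τ : Representation k Γ (ι →₀ V)} (hτ : ∀ (g : Γ) (v : ι →₀ V), τ g v = Finsupp.mapRange (ρ g) (map_zero _) (Finsupp.equivMapDomain (a g).toEquiv v))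
variable {τ₁ : Representation k Γ (G.edgeSet →₀ V)}
  (hτ₁ : ∀ (g : Γ) (c : G.edgeSet →₀ V), τ₁ g c = Finsupp.mapRange (ρ g) (map_zero _) (Finsupp.equivMapDomain (a g).mapEdgeSet c))

omit [CharZero k] [TopologicalSpace Γ] [IsTopologicalGroup Γ] [DecidableEq ι] in
/-- `(g g′)·e = g·(g′·e)` on edges. [cite: SchneiderStuhler1997, Ch. II §3] -/
theorem mapEdgeSet_mul (g g' : Γ) (e : G.edgeSet) : (a (g * g')).mapEdgeSet e = (a g).mapEdgeSet ((a g').mapEdgeSet e) := by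
  apply Subtype.ext
  show Sym2.map (a (g * g')) (e : Sym2 ι) = Sym2.map (a g) (Sym2.map (a g') (e : Sym2 ι))
  rw [map_mul, RelIso.coe_mul, Sym2.map_map]

omit [CharZero k] [TopologicalSpace Γ] [IsTopologicalGroup Γ] [DecidableEq ι] in
/-- `1·e = e` on edges. [cite: SchneiderStuhler1997, Ch. II §3] -/
theorem mapEdgeSet_one (e : G.edgeSet) : (a 1).mapEdgeSet e = e := by
  apply Subtype.ext
  show Sym2.map (a 1) (e : Sym2 ι) = e
  rw [map_one, RelIso.coe_one, Sym2.map_id, id]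

include hτ hτ₁ in
/-- **THE ISOTYPIC EULER IDENTITY OF THE JACQUET MODULE OF THE SCHNEIDER–STUHLER RESOLUTION ON THE TREE** (★ 4χ(b) `sum_finrank_block_eigen_eq_of_shortExact` at FILE 5a's global complex,
`hsurj` by §1): `Σ_{r ∈ S₁} dim ([W¹_r] ⊓ E₁) = Σ_{r ∈ S₀} dim ([W⁰_r] ⊓ E₀)`, `[W^q_r]` the image in the Jacquet module `(C_q(X))_N` of the block of the facet `r`, `E_q` the `χ`-eigenspace of
the compact `C ≤ M`, `S_q` the height-`0` orbit representatives of dimension `q` — the `hEuler` of ★ 47d HEAD in the (E)-currency.  The Bruhat–Tits datum (`R rep tr ht τ C χ E`) is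
hypothesis-style (row 47e). [cite: SchneiderStuhler1997, Ch. III §4 Lemma III.4.13] [cite: BernsteinZelevinsky1976, §2.3, Prop. 2.35] [cite: Casselman1995, §6.3] -/
theorem sum_finrank_block_eigen_eq_of_tree (hT : G.IsTree) (σ : Orientation G) (U : ι → Subgroup Γ) (hU : ∀ z, IsCompact (U z : Set Γ)) (hUo : ∀ x, IsOpen (U x : Set Γ))
    (hU6 : ∀ x y, G.Adj x y → ((U x ⊔ U y : Subgroup Γ) : Set Γ) = (U x : Set Γ) * (U y : Set Γ))
    (hU7 : ∀ x y z, G.Adj x y → G.dist y z + 1 = G.dist x z → ((U y : Subgroup Γ) : Set Γ) ⊆ (U x : Set Γ) * (U z : Set Γ))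
    (hUa : ∀ (g : Γ) (x : ι), U (a g x) = (U x).map (MulAut.conj g).toMonoidHom)
    (hσa : ∀ (g : Γ) (e : G.edgeSet), σ.head ((a g).mapEdgeSet e) = a g (σ.head e) ∧ σ.tail ((a g).mapEdgeSet e) = a g (σ.tail e))
    (hstab : ∀ x : ι, IsOpen {g : Γ | a g x = x}) (hρ : ρ.IsSmooth) (hfd : ∀ x, FiniteDimensional k (ρ.fixedPoints (U x)))
    {D : (G.edgeSet →₀ V) →ₗ[k] (ι →₀ V)} (hD : ∀ (c : G.edgeSet →₀ V) (u : ι), D c u = c.sum fun e m => σ.incMatrix k u e • m)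
    {E : (ι →₀ V) →ₗ[k] V} (hE : ∀ v : ι →₀ V, E v = v.sum fun _ m => m)
    -- the three `Γ`-representations (FILE 5a `exists_reps_univ`)
    {ρ₁ : Representation k Γ ↥(⨆ e ∈ {e : G.edgeSet | σ.head e ∈ (Set.univ : Set ι) ∧ σ.tail e ∈ (Set.univ : Set ι)},
      (ρ.fixedPoints (U (σ.head e) ⊔ U (σ.tail e))).map (Finsupp.lsingle e : V →ₗ[k] G.edgeSet →₀ V))}
    (hρ₁ : ∀ (g : Γ) c, ((ρ₁ g c : _) : G.edgeSet →₀ V) = τ₁ g c)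
    {ρ₀ : Representation k Γ ↥(⨆ x ∈ (Set.univ : Set ι), (ρ.fixedPoints (U x)).map (Finsupp.lsingle x : V →ₗ[k] ι →₀ V))}
    (hρ₀ : ∀ (g : Γ) v, ((ρ₀ g v : _) : ι →₀ V) = τ g v)
    {ρV : Representation k Γ ↥(⨆ x ∈ (Set.univ : Set ι), ρ.fixedPoints (U x))} (hρV : ∀ (g : Γ) w, ((ρV g w : _) : V) = ρ g w)
    -- the parabolic triple and the Bruhat–Tits datum (hypothesis-style)
    (t : ParabolicTriple Γ) (hN : IsLimitOfCompactOpen t.N)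
    {R₁ : Set G.edgeSet} (rep₁ : G.edgeSet → G.edgeSet) (tr₁ : G.edgeSet → Γ) (htrN₁ : ∀ b, tr₁ b ∈ t.N) (hrepR₁ : ∀ b, rep₁ b ∈ R₁)
    (htr₁ : ∀ b, (a (tr₁ b)).mapEdgeSet (rep₁ b) = b) (hrep_act₁ : ∀ n ∈ t.N, ∀ b, rep₁ ((a n).mapEdgeSet b) = rep₁ b) (hrep_id₁ : ∀ r ∈ R₁, rep₁ r = r) (ht₁ : G.edgeSet → ℤ)
    {R₀ : Set ι} (rep₀ : ι → ι) (tr₀ : ι → Γ) (htrN₀ : ∀ b, tr₀ b ∈ t.N) (hrepR₀ : ∀ b, rep₀ b ∈ R₀)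
    (htr₀ : ∀ b, a (tr₀ b) (rep₀ b) = b) (hrep_act₀ : ∀ n ∈ t.N, ∀ b, rep₀ (a n b) = rep₀ b) (hrep_id₀ : ∀ r ∈ R₀, rep₀ r = r) (ht₀ : ι → ℤ)
    {τM : Γ} (hτM : τM ∈ t.M) (hsh₁ : ∀ r ∈ R₁, ht₁ (rep₁ ((a τM).mapEdgeSet r)) = ht₁ r + 1) (hsh₁' : ∀ r' ∈ R₁, ∃ r ∈ R₁, rep₁ ((a τM).mapEdgeSet r) = r')
    (hsh₀ : ∀ r ∈ R₀, ht₀ (rep₀ (a τM r)) = ht₀ r + 1) (hsh₀' : ∀ r' ∈ R₀, ∃ r ∈ R₀, rep₀ (a τM r) = r')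
    (hVN : FiniteDimensional k (t.restrict ρV).Coinvariants)
    (C : Subgroup Γ) (hCM : C ≤ t.M) (hC : IsCompact (C : Set Γ)) (hCτ : ∀ c ∈ C, c * τM = τM * c)
    (hCR₁ : ∀ c ∈ C, ∀ r ∈ R₁, (a c).mapEdgeSet r = r) (hCR₀ : ∀ c ∈ C, ∀ r ∈ R₀, a c r = r) (χ : C →* kˣ) (hχo : IsOpen (χ.ker : Set C))
    {E₁ : Submodule k (t.restrict ρ₁).Coinvariants} (hE₁ : ∀ x, x ∈ E₁ ↔ ∀ c : C, (ρ₁.jacquetModule t ⟨c, hCM c.2⟩ : _ →ₗ[k] _) x = ((χ c : kˣ) : k) • x)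
    {E₀ : Submodule k (t.restrict ρ₀).Coinvariants} (hE₀ : ∀ x, x ∈ E₀ ↔ ∀ c : C, (ρ₀.jacquetModule t ⟨c, hCM c.2⟩ : _ →ₗ[k] _) x = ((χ c : kˣ) : k) • x)
    {EV : Submodule k (t.restrict ρV).Coinvariants} (hEV : ∀ x, x ∈ EV ↔ ∀ c : C, (ρV.jacquetModule t ⟨c, hCM c.2⟩ : _ →ₗ[k] _) x = ((χ c : kˣ) : k) • x)
    (S₁ : Finset G.edgeSet) (hS₁ : ∀ r, r ∈ S₁ ↔ r ∈ R₁ ∧ ht₁ r = 0) (S₀ : Finset ι) (hS₀ : ∀ r, r ∈ S₀ ↔ r ∈ R₀ ∧ ht₀ r = 0) :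
    ∑ r ∈ S₁, Module.finrank k ↥(((((ρ.fixedPoints (U (σ.head r) ⊔ U (σ.tail r))).map (Finsupp.lsingle r : V →ₗ[k] G.edgeSet →₀ V)).comap
        (⨆ e ∈ {e : G.edgeSet | σ.head e ∈ (Set.univ : Set ι) ∧ σ.tail e ∈ (Set.univ : Set ι)},
          (ρ.fixedPoints (U (σ.head e) ⊔ U (σ.tail e))).map (Finsupp.lsingle e : V →ₗ[k] G.edgeSet →₀ V)).subtype).map (Coinvariants.mk (t.restrict ρ₁))) ⊓ E₁) =
      ∑ r ∈ S₀, Module.finrank k ↥(((((ρ.fixedPoints (U r)).map (Finsupp.lsingle r : V →ₗ[k] ι →₀ V)).comap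
        (⨆ x ∈ (Set.univ : Set ι), (ρ.fixedPoints (U x)).map (Finsupp.lsingle x : V →ₗ[k] ι →₀ V)).subtype).map (Coinvariants.mk (t.restrict ρ₀))) ⊓ E₀) := by
  classical
  -- FILE 5a: intertwining boundary ∕ augmentation, the short exact sequence, smoothness of `C₀(X)`
  have hDC := fun c hc => boundaryMap_mem_zeroChains (ρ := ρ) σ U (Set.univ : Set ι) hD (c := c) hc
  have hEC := fun v hv => augmentationMap_mem_restricted (ρ := ρ) U (Set.univ : Set ι) hE (v := v) hv
  obtain ⟨f, hf⟩ := exists_intertwiningMap_boundary hτ hτ₁ σ U Set.univ hσa hD hDC hρ₁ hρ₀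
  obtain ⟨q, hq⟩ := exists_intertwiningMap_augmentation hτ U Set.univ hE hEC hρ₀ hρV
  obtain ⟨hinj, hexact, hsurj⟩ := shortExact_univ hT σ U hU hU6 hU7 hρ hD hE hDC hEC f hf q hq
  have h₀ : ρ₀.IsSmooth := isSmooth_rep_zeroChains_univ hτ hstab U hUo Set.univ hρ₀
  -- the edge fixed spaces are finite-dimensional too
  haveI : ∀ e : G.edgeSet, FiniteDimensional k (ρ.fixedPoints (U (σ.head e) ⊔ U (σ.tail e))) := fun e =>
    Submodule.finiteDimensional_of_le (fun v hv => (mem_fixedPoints _ _ _).2 fun u hu => (mem_fixedPoints _ _ _).1 hv u (Subgroup.mem_sup_left hu))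
  exact sum_finrank_block_eigen_eq_of_shortExact t hN h₀ f q hinj hexact hsurj
    (isInternal_oneBlocks_univ σ U) (fun g g' b => mapEdgeSet_mul g g' b) (fun b => mapEdgeSet_one b)
    (fun g b m hm => rep_mem_oneBlock hτ₁ σ U Set.univ hUa hσa hρ₁ g b m hm)
    rep₁ tr₁ htrN₁ hrepR₁ htr₁ hrep_act₁ hrep_id₁ ht₁ (fun b => finiteDimensional_oneBlock σ U Set.univ ⟨Set.mem_univ _, Set.mem_univ _⟩)
    (isInternal_zeroBlocks_univ U) (fun g g' b => by rw [map_mul]; rfl) (fun b => by rw [map_one]; rfl)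
    (fun g b m hm => rep_mem_zeroBlock hτ U Set.univ hUa hρ₀ g b m hm)
    rep₀ tr₀ htrN₀ hrepR₀ htr₀ hrep_act₀ hrep_id₀ ht₀ (fun b => finiteDimensional_zeroBlock U Set.univ (Set.mem_univ b))
    hτM hsh₁ hsh₁' hsh₀ hsh₀' hVN C hCM hCτ hCR₁ hCR₀ (fun c => ((χ c : kˣ) : k)) hE₁ hE₀ hEV
    (exists_mem_eigen_jacquetMap_eq t h₀ q hsurj C hCM hC χ hχo hE₀ hEV) S₁ hS₁ S₀ hS₀

end Tree

end Representation
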